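import Mathlib

/-!
# Five-fold bonds form chains: degree two at every deep five-fold site (S2γ, part α)

Crux `SquareWellLayerCake.GapTwelveToBarlow` (stmt-AtomisticToContinuum-15807), line `Sketch`,
wave 3 of `stub_fiveFoldLinear`.  Under the two hypotheses of that stub —

* (ExtendedGap) a site all of whose `4`-ball is Good has no pair distance in `(1, 131/100)`;
* (Continuation) a Good site with the local dichotomy that carries one five-fold bond carries
  exactly two, at an angle with cosine `≤ -19/20` —

every site `j` of an all-Good `2D`-ball about `x i` that is *deep* (`dist (x i) (x j) + 5 ≤ 2D`)
has five-fold degree `0` or exactly `2`, the two five-fold bonds being nearly opposite; and the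
five-fold relation is symmetric.  So inside the deep region the five-fold bond graph is a
disjoint union of paths and cycles ("chains") whose ends, if any, lie within `5` of the sphere
of radius `2D`.  This is the combinatorial input (α) of the wave-3 plan
`work/stubs/fiveFoldLinear-PLAN-w3.md`; the metric input (how straight a chain is) is NOT a
consequence of the link geometry — see the plan, §β.

Mathlib only; no named fact is used; nothing is defined.
-/

namespace Summit.AtomisticToContinuum.Crystallization.Theorems.SquareWellLayerCakeGapTwelveToBarlow

/-! ## Symmetry of the five-fold relation -/

/-- The common-neighbour set of a pair is symmetric in the pair. [folklore] -/
theorem commonNbrs_comm {N : ℕ} (x : Fin N → EuclideanSpace ℝ (Fin 3)) (j k : Fin N) :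
    (Finset.univ.filter fun l : Fin N =>
        l ≠ j ∧ l ≠ k ∧ dist (x j) (x l) ≤ 1 ∧ dist (x k) (x l) ≤ 1) =
      (Finset.univ.filter fun l : Fin N =>
        l ≠ k ∧ l ≠ j ∧ dist (x k) (x l) ≤ 1 ∧ dist (x j) (x l) ≤ 1) := by
  ext l
  simp only [Finset.mem_filter, Finset.mem_univ, true_and]
  tauto

/-- The five-fold relation (`j ≠ k`, bonded, exactly five common neighbours) is symmetric.
[folklore] -/
theorem fiveFold_symm {N : ℕ} (x : Fin N → EuclideanSpace ℝ (Fin 3)) {j k : Fin N}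
    (hjk : j ≠ k) (hdjk : dist (x j) (x k) ≤ 1)
    (h5 : (Finset.univ.filter fun l : Fin N =>
        l ≠ j ∧ l ≠ k ∧ dist (x j) (x l) ≤ 1 ∧ dist (x k) (x l) ≤ 1).card = 5) :
    k ≠ j ∧ dist (x k) (x j) ≤ 1 ∧
      (Finset.univ.filter fun l : Fin N =>
        l ≠ k ∧ l ≠ j ∧ dist (x k) (x l) ≤ 1 ∧ dist (x j) (x l) ≤ 1).card = 5 := by
  refine ⟨hjk.symm, by rwa [dist_comm], ?_⟩
  rwa [← commonNbrs_comm x j k]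

/-! ## The local dichotomy at a deep site -/

/-- Under (ExtendedGap), at a site `j` with `dist (x i) (x j) + 5 ≤ 2D` of an all-Good `2D`-ball
about `x i`, no two neighbours of `j` are at distance in `(1, 131/100)`. [folklore] -/
theorem localGap_of_deep
    (hGap : ∀ (N : ℕ) (x : Fin N → EuclideanSpace ℝ (Fin 3)) (i j : Fin N),
      (∀ l : Fin N, dist (x i) (x l) ≤ 4 →
        ((∀ j' : Fin N, dist (x l) (x j') ≤ 11 / 10 → ∀ k : Fin N, k ≠ j' →
            (55 : ℝ) / 57 ≤ dist (x j') (x k)) ∧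
          (Finset.univ.filter fun j' : Fin N => j' ≠ l ∧ dist (x l) (x j') ≤ 1).card = 12 ∧
          (Finset.univ.filter fun j' : Fin N => j' ≠ l ∧ dist (x l) (x j') ≤ 11 / 10).card ≤ 12)) →
      1 < dist (x i) (x j) → (131 : ℝ) / 100 ≤ dist (x i) (x j))
    {N : ℕ} (x : Fin N → EuclideanSpace ℝ (Fin 3)) (i : Fin N) (D : ℝ)
    (hGood : ∀ j : Fin N, dist (x i) (x j) ≤ 2 * D →
        ((∀ j' : Fin N, dist (x j) (x j') ≤ 11 / 10 → ∀ k : Fin N, k ≠ j' →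
            (55 : ℝ) / 57 ≤ dist (x j') (x k)) ∧
          (Finset.univ.filter fun j' : Fin N => j' ≠ j ∧ dist (x j) (x j') ≤ 1).card = 12 ∧
          (Finset.univ.filter fun j' : Fin N => j' ≠ j ∧ dist (x j) (x j') ≤ 11 / 10).card ≤ 12))
    (j : Fin N) (hj : dist (x i) (x j) + 5 ≤ 2 * D) :
    ∀ l l' : Fin N, dist (x j) (x l) ≤ 1 → dist (x j) (x l') ≤ 1 → 1 < dist (x l) (x l') →
      (131 : ℝ) / 100 ≤ dist (x l) (x l') := by
  intro l l' hjl _ hgt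
  refine hGap N x l l' (fun l'' h4 => hGood l'' ?_) hgt
  calc dist (x i) (x l'') ≤ dist (x i) (x j) + dist (x j) (x l) + dist (x l) (x l'') :=
        dist_triangle4 _ _ _ _
    _ ≤ 2 * D := by linarith

/-! ## (α) Degree two at deep five-fold sites -/

/-- **Chains, part α.**  Under (ExtendedGap) and (Continuation), a deep site `j`
(`dist (x i) (x j) + 5 ≤ 2D`) of an all-Good `2D`-ball that carries a five-fold bond `(j,k)`
carries exactly two five-fold bonds, and any other five-fold bond `(j,k')` makes an angle with
cosine `≤ -19/20` with `(j,k)`. [folklore] -/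
theorem fiveFold_degree_two_of_deep
    (hGap : ∀ (N : ℕ) (x : Fin N → EuclideanSpace ℝ (Fin 3)) (i j : Fin N),
      (∀ l : Fin N, dist (x i) (x l) ≤ 4 →
        ((∀ j' : Fin N, dist (x l) (x j') ≤ 11 / 10 → ∀ k : Fin N, k ≠ j' →
            (55 : ℝ) / 57 ≤ dist (x j') (x k)) ∧
          (Finset.univ.filter fun j' : Fin N => j' ≠ l ∧ dist (x l) (x j') ≤ 1).card = 12 ∧
          (Finset.univ.filter fun j' : Fin N => j' ≠ l ∧ dist (x l) (x j') ≤ 11 / 10).card ≤ 12)) →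
      1 < dist (x i) (x j) → (131 : ℝ) / 100 ≤ dist (x i) (x j))
    (hCont : ∀ (N : ℕ) (x : Fin N → EuclideanSpace ℝ (Fin 3)) (j k : Fin N),
      ((∀ j' : Fin N, dist (x j) (x j') ≤ 11 / 10 → ∀ k' : Fin N, k' ≠ j' →
          (55 : ℝ) / 57 ≤ dist (x j') (x k')) ∧
        (Finset.univ.filter fun j' : Fin N => j' ≠ j ∧ dist (x j) (x j') ≤ 1).card = 12 ∧
        (Finset.univ.filter fun j' : Fin N => j' ≠ j ∧ dist (x j) (x j') ≤ 11 / 10).card ≤ 12) →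
      (∀ l l' : Fin N, dist (x j) (x l) ≤ 1 → dist (x j) (x l') ≤ 1 → 1 < dist (x l) (x l') →
        (131 : ℝ) / 100 ≤ dist (x l) (x l')) →
      j ≠ k → dist (x j) (x k) ≤ 1 →
      (Finset.univ.filter fun l : Fin N =>
        l ≠ j ∧ l ≠ k ∧ dist (x j) (x l) ≤ 1 ∧ dist (x k) (x l) ≤ 1).card = 5 →
      (Finset.univ.filter fun k' : Fin N => k' ≠ j ∧ dist (x j) (x k') ≤ 1 ∧
        (Finset.univ.filter fun l : Fin N =>
          l ≠ j ∧ l ≠ k' ∧ dist (x j) (x l) ≤ 1 ∧ dist (x k') (x l) ≤ 1).card = 5).card = 2 ∧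
      ∀ k' : Fin N, k' ≠ j → dist (x j) (x k') ≤ 1 →
        (Finset.univ.filter fun l : Fin N =>
          l ≠ j ∧ l ≠ k' ∧ dist (x j) (x l) ≤ 1 ∧ dist (x k') (x l) ≤ 1).card = 5 → k' ≠ k →
        inner ℝ (x k - x j) (x k' - x j) ≤ -((19 : ℝ) / 20) * (‖x k - x j‖ * ‖x k' - x j‖))
    {N : ℕ} (x : Fin N → EuclideanSpace ℝ (Fin 3)) (i : Fin N) (D : ℝ)
    (hGood : ∀ j : Fin N, dist (x i) (x j) ≤ 2 * D →
        ((∀ j' : Fin N, dist (x j) (x j') ≤ 11 / 10 → ∀ k : Fin N, k ≠ j' →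
            (55 : ℝ) / 57 ≤ dist (x j') (x k)) ∧
          (Finset.univ.filter fun j' : Fin N => j' ≠ j ∧ dist (x j) (x j') ≤ 1).card = 12 ∧
          (Finset.univ.filter fun j' : Fin N => j' ≠ j ∧ dist (x j) (x j') ≤ 11 / 10).card ≤ 12))
    (j k : Fin N) (hj : dist (x i) (x j) + 5 ≤ 2 * D) (hjk : j ≠ k) (hdjk : dist (x j) (x k) ≤ 1)
    (h5 : (Finset.univ.filter fun l : Fin N =>
        l ≠ j ∧ l ≠ k ∧ dist (x j) (x l) ≤ 1 ∧ dist (x k) (x l) ≤ 1).card = 5) :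
    (Finset.univ.filter fun k' : Fin N => k' ≠ j ∧ dist (x j) (x k') ≤ 1 ∧
        (Finset.univ.filter fun l : Fin N =>
          l ≠ j ∧ l ≠ k' ∧ dist (x j) (x l) ≤ 1 ∧ dist (x k') (x l) ≤ 1).card = 5).card = 2 ∧
      ∀ k' : Fin N, k' ≠ j → dist (x j) (x k') ≤ 1 →
        (Finset.univ.filter fun l : Fin N =>
          l ≠ j ∧ l ≠ k' ∧ dist (x j) (x l) ≤ 1 ∧ dist (x k') (x l) ≤ 1).card = 5 → k' ≠ k →
        inner ℝ (x k - x j) (x k' - x j) ≤ -((19 : ℝ) / 20) * (‖x k - x j‖ * ‖x k' - x j‖) :=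
  hCont N x j k (hGood j (by linarith [dist_nonneg (x := x j) (y := x k)]))
    (localGap_of_deep hGap x i D hGood j hj) hjk hdjk h5

/-- **Chains, part α (degree dichotomy).**  Under (ExtendedGap) and (Continuation), every deep
site of an all-Good `2D`-ball has five-fold degree `0` or `2`; in the latter case any two
distinct five-fold bonds at the site have cosine `≤ -19/20`. [folklore] -/
theorem fiveFold_degree_zero_or_two_of_deep
    (hGap : ∀ (N : ℕ) (x : Fin N → EuclideanSpace ℝ (Fin 3)) (i j : Fin N),
      (∀ l : Fin N, dist (x i) (x l) ≤ 4 →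
        ((∀ j' : Fin N, dist (x l) (x j') ≤ 11 / 10 → ∀ k : Fin N, k ≠ j' →
            (55 : ℝ) / 57 ≤ dist (x j') (x k)) ∧
          (Finset.univ.filter fun j' : Fin N => j' ≠ l ∧ dist (x l) (x j') ≤ 1).card = 12 ∧
          (Finset.univ.filter fun j' : Fin N => j' ≠ l ∧ dist (x l) (x j') ≤ 11 / 10).card ≤ 12)) →
      1 < dist (x i) (x j) → (131 : ℝ) / 100 ≤ dist (x i) (x j))
    (hCont : ∀ (N : ℕ) (x : Fin N → EuclideanSpace ℝ (Fin 3)) (j k : Fin N),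
      ((∀ j' : Fin N, dist (x j) (x j') ≤ 11 / 10 → ∀ k' : Fin N, k' ≠ j' →
          (55 : ℝ) / 57 ≤ dist (x j') (x k')) ∧
        (Finset.univ.filter fun j' : Fin N => j' ≠ j ∧ dist (x j) (x j') ≤ 1).card = 12 ∧
        (Finset.univ.filter fun j' : Fin N => j' ≠ j ∧ dist (x j) (x j') ≤ 11 / 10).card ≤ 12) →
      (∀ l l' : Fin N, dist (x j) (x l) ≤ 1 → dist (x j) (x l') ≤ 1 → 1 < dist (x l) (x l') →
        (131 : ℝ) / 100 ≤ dist (x l) (x l')) →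
      j ≠ k → dist (x j) (x k) ≤ 1 →
      (Finset.univ.filter fun l : Fin N =>
        l ≠ j ∧ l ≠ k ∧ dist (x j) (x l) ≤ 1 ∧ dist (x k) (x l) ≤ 1).card = 5 →
      (Finset.univ.filter fun k' : Fin N => k' ≠ j ∧ dist (x j) (x k') ≤ 1 ∧
        (Finset.univ.filter fun l : Fin N =>
          l ≠ j ∧ l ≠ k' ∧ dist (x j) (x l) ≤ 1 ∧ dist (x k') (x l) ≤ 1).card = 5).card = 2 ∧
      ∀ k' : Fin N, k' ≠ j → dist (x j) (x k') ≤ 1 →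
        (Finset.univ.filter fun l : Fin N =>
          l ≠ j ∧ l ≠ k' ∧ dist (x j) (x l) ≤ 1 ∧ dist (x k') (x l) ≤ 1).card = 5 → k' ≠ k →
        inner ℝ (x k - x j) (x k' - x j) ≤ -((19 : ℝ) / 20) * (‖x k - x j‖ * ‖x k' - x j‖))
    {N : ℕ} (x : Fin N → EuclideanSpace ℝ (Fin 3)) (i : Fin N) (D : ℝ)
    (hGood : ∀ j : Fin N, dist (x i) (x j) ≤ 2 * D →
        ((∀ j' : Fin N, dist (x j) (x j') ≤ 11 / 10 → ∀ k : Fin N, k ≠ j' →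
            (55 : ℝ) / 57 ≤ dist (x j') (x k)) ∧
          (Finset.univ.filter fun j' : Fin N => j' ≠ j ∧ dist (x j) (x j') ≤ 1).card = 12 ∧
          (Finset.univ.filter fun j' : Fin N => j' ≠ j ∧ dist (x j) (x j') ≤ 11 / 10).card ≤ 12))
    (j : Fin N) (hj : dist (x i) (x j) + 5 ≤ 2 * D) :
    (Finset.univ.filter fun k' : Fin N => k' ≠ j ∧ dist (x j) (x k') ≤ 1 ∧
        (Finset.univ.filter fun l : Fin N =>
          l ≠ j ∧ l ≠ k' ∧ dist (x j) (x l) ≤ 1 ∧ dist (x k') (x l) ≤ 1).card = 5).card = 0 ∨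
    ((Finset.univ.filter fun k' : Fin N => k' ≠ j ∧ dist (x j) (x k') ≤ 1 ∧
        (Finset.univ.filter fun l : Fin N =>
          l ≠ j ∧ l ≠ k' ∧ dist (x j) (x l) ≤ 1 ∧ dist (x k') (x l) ≤ 1).card = 5).card = 2 ∧
      ∀ k ∈ (Finset.univ.filter fun k' : Fin N => k' ≠ j ∧ dist (x j) (x k') ≤ 1 ∧
        (Finset.univ.filter fun l : Fin N =>
          l ≠ j ∧ l ≠ k' ∧ dist (x j) (x l) ≤ 1 ∧ dist (x k') (x l) ≤ 1).card = 5),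
      ∀ k' ∈ (Finset.univ.filter fun k' : Fin N => k' ≠ j ∧ dist (x j) (x k') ≤ 1 ∧
        (Finset.univ.filter fun l : Fin N =>
          l ≠ j ∧ l ≠ k' ∧ dist (x j) (x l) ≤ 1 ∧ dist (x k') (x l) ≤ 1).card = 5),
      k' ≠ k →
        inner ℝ (x k - x j) (x k' - x j) ≤ -((19 : ℝ) / 20) * (‖x k - x j‖ * ‖x k' - x j‖)) := by
  set P := (Finset.univ.filter fun k' : Fin N => k' ≠ j ∧ dist (x j) (x k') ≤ 1 ∧
        (Finset.univ.filter fun l : Fin N =>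
          l ≠ j ∧ l ≠ k' ∧ dist (x j) (x l) ≤ 1 ∧ dist (x k') (x l) ≤ 1).card = 5) with hP
  by_cases h0 : P.card = 0
  · exact Or.inl h0
  · right
    obtain ⟨k, hk⟩ := Finset.card_pos.mp (Nat.pos_of_ne_zero h0)
    have hk' := hk
    rw [hP, Finset.mem_filter] at hk'
    obtain ⟨_, hkj, hdjk, h5⟩ := hk'
    have hmain := fiveFold_degree_two_of_deep hGap hCont x i D hGood j k hj (Ne.symm hkj) hdjk h5
    refine ⟨hmain.1, ?_⟩
    intro k₁ hk₁ k₂ hk₂ hne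
    rw [hP, Finset.mem_filter] at hk₁ hk₂
    obtain ⟨_, hk₁j, hd₁, h5₁⟩ := hk₁
    obtain ⟨_, hk₂j, hd₂, h5₂⟩ := hk₂
    have h₁ := fiveFold_degree_two_of_deep hGap hCont x i D hGood j k₁ hj (Ne.symm hk₁j) hd₁ h5₁
    exact h₁.2 k₂ hk₂j hd₂ h5₂ hne

/-- **Chain continuation.**  Under (ExtendedGap) and (Continuation), a five-fold bond `(j,k)` at
a deep site `j` of an all-Good `2D`-ball continues through `j` by exactly one further
five-fold bond `(j,k')`, `k' ≠ k`, nearly opposite to `(j,k)`; every five-fold partner of `j`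
is `k` or `k'`. [folklore] -/
theorem fiveFold_exists_next
    (hGap : ∀ (N : ℕ) (x : Fin N → EuclideanSpace ℝ (Fin 3)) (i j : Fin N),
      (∀ l : Fin N, dist (x i) (x l) ≤ 4 →
        ((∀ j' : Fin N, dist (x l) (x j') ≤ 11 / 10 → ∀ k : Fin N, k ≠ j' →
            (55 : ℝ) / 57 ≤ dist (x j') (x k)) ∧
          (Finset.univ.filter fun j' : Fin N => j' ≠ l ∧ dist (x l) (x j') ≤ 1).card = 12 ∧
          (Finset.univ.filter fun j' : Fin N => j' ≠ l ∧ dist (x l) (x j') ≤ 11 / 10).card ≤ 12)) →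
      1 < dist (x i) (x j) → (131 : ℝ) / 100 ≤ dist (x i) (x j))
    (hCont : ∀ (N : ℕ) (x : Fin N → EuclideanSpace ℝ (Fin 3)) (j k : Fin N),
      ((∀ j' : Fin N, dist (x j) (x j') ≤ 11 / 10 → ∀ k' : Fin N, k' ≠ j' →
          (55 : ℝ) / 57 ≤ dist (x j') (x k')) ∧
        (Finset.univ.filter fun j' : Fin N => j' ≠ j ∧ dist (x j) (x j') ≤ 1).card = 12 ∧
        (Finset.univ.filter fun j' : Fin N => j' ≠ j ∧ dist (x j) (x j') ≤ 11 / 10).card ≤ 12) →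
      (∀ l l' : Fin N, dist (x j) (x l) ≤ 1 → dist (x j) (x l') ≤ 1 → 1 < dist (x l) (x l') →
        (131 : ℝ) / 100 ≤ dist (x l) (x l')) →
      j ≠ k → dist (x j) (x k) ≤ 1 →
      (Finset.univ.filter fun l : Fin N =>
        l ≠ j ∧ l ≠ k ∧ dist (x j) (x l) ≤ 1 ∧ dist (x k) (x l) ≤ 1).card = 5 →
      (Finset.univ.filter fun k' : Fin N => k' ≠ j ∧ dist (x j) (x k') ≤ 1 ∧
        (Finset.univ.filter fun l : Fin N =>
          l ≠ j ∧ l ≠ k' ∧ dist (x j) (x l) ≤ 1 ∧ dist (x k') (x l) ≤ 1).card = 5).card = 2 ∧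
      ∀ k' : Fin N, k' ≠ j → dist (x j) (x k') ≤ 1 →
        (Finset.univ.filter fun l : Fin N =>
          l ≠ j ∧ l ≠ k' ∧ dist (x j) (x l) ≤ 1 ∧ dist (x k') (x l) ≤ 1).card = 5 → k' ≠ k →
        inner ℝ (x k - x j) (x k' - x j) ≤ -((19 : ℝ) / 20) * (‖x k - x j‖ * ‖x k' - x j‖))
    {N : ℕ} (x : Fin N → EuclideanSpace ℝ (Fin 3)) (i : Fin N) (D : ℝ)
    (hGood : ∀ j : Fin N, dist (x i) (x j) ≤ 2 * D →
        ((∀ j' : Fin N, dist (x j) (x j') ≤ 11 / 10 → ∀ k : Fin N, k ≠ j' →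
            (55 : ℝ) / 57 ≤ dist (x j') (x k)) ∧
          (Finset.univ.filter fun j' : Fin N => j' ≠ j ∧ dist (x j) (x j') ≤ 1).card = 12 ∧
          (Finset.univ.filter fun j' : Fin N => j' ≠ j ∧ dist (x j) (x j') ≤ 11 / 10).card ≤ 12))
    (j k : Fin N) (hj : dist (x i) (x j) + 5 ≤ 2 * D) (hjk : j ≠ k) (hdjk : dist (x j) (x k) ≤ 1)
    (h5 : (Finset.univ.filter fun l : Fin N =>
        l ≠ j ∧ l ≠ k ∧ dist (x j) (x l) ≤ 1 ∧ dist (x k) (x l) ≤ 1).card = 5) :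
    ∃ k' : Fin N, k' ≠ k ∧ k' ≠ j ∧ dist (x j) (x k') ≤ 1 ∧
      (Finset.univ.filter fun l : Fin N =>
        l ≠ j ∧ l ≠ k' ∧ dist (x j) (x l) ≤ 1 ∧ dist (x k') (x l) ≤ 1).card = 5 ∧
      inner ℝ (x k - x j) (x k' - x j) ≤ -((19 : ℝ) / 20) * (‖x k - x j‖ * ‖x k' - x j‖) ∧
      ∀ k'' : Fin N, k'' ≠ j → dist (x j) (x k'') ≤ 1 →
        (Finset.univ.filter fun l : Fin N =>
          l ≠ j ∧ l ≠ k'' ∧ dist (x j) (x l) ≤ 1 ∧ dist (x k'') (x l) ≤ 1).card = 5 →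
        k'' = k ∨ k'' = k' := by
  have hmain := fiveFold_degree_two_of_deep hGap hCont x i D hGood j k hj hjk hdjk h5
  set P := (Finset.univ.filter fun k' : Fin N => k' ≠ j ∧ dist (x j) (x k') ≤ 1 ∧
        (Finset.univ.filter fun l : Fin N =>
          l ≠ j ∧ l ≠ k' ∧ dist (x j) (x l) ≤ 1 ∧ dist (x k') (x l) ≤ 1).card = 5) with hP
  have hkP : k ∈ P := by
    rw [hP, Finset.mem_filter]
    exact ⟨Finset.mem_univ _, hjk.symm, hdjk, h5⟩
  have hcard : (P.erase k).card = 1 := by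
    rw [Finset.card_erase_of_mem hkP, hmain.1]
  obtain ⟨k', hk'⟩ := Finset.card_eq_one.mp hcard
  have hk'mem : k' ∈ P.erase k := by rw [hk']; exact Finset.mem_singleton_self _
  rw [Finset.mem_erase] at hk'mem
  obtain ⟨hk'k, hk'P⟩ := hk'mem
  have hk'P' := hk'P
  rw [hP, Finset.mem_filter] at hk'P'
  obtain ⟨_, hk'j, hd', h5'⟩ := hk'P'
  refine ⟨k', hk'k, hk'j, hd', h5', hmain.2 k' hk'j hd' h5' hk'k, ?_⟩
  intro k'' hk''j hd'' h5''
  by_cases h : k'' = k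
  · exact Or.inl h
  · right
    have hmem : k'' ∈ P.erase k := by
      rw [Finset.mem_erase, hP, Finset.mem_filter]
      exact ⟨h, Finset.mem_univ _, hk''j, hd'', h5''⟩
    rw [hk'] at hmem
    exact Finset.mem_singleton.mp hmem

/-- Registered closed form of (α) (`fiveFold_degree_zero_or_two_of_deep`, wave 3 of
`stub_fiveFoldLinear`, line `Sketch`): under (ExtendedGap) and (Continuation), every deep site
(`dist (x i) (x j) + 5 ≤ 2D`) of an all-Good `2D`-ball has five-fold degree `0` or `2`, and in the
latter case its two five-fold bonds have cosine `≤ -19/20`. [folklore] -/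
theorem stub_fiveFoldChains :
    (∀ (N : ℕ) (x : Fin N → EuclideanSpace ℝ (Fin 3)) (i j : Fin N),
      (∀ l : Fin N, dist (x i) (x l) ≤ 4 →
        ((∀ j' : Fin N, dist (x l) (x j') ≤ 11 / 10 → ∀ k : Fin N, k ≠ j' →
            (55 : ℝ) / 57 ≤ dist (x j') (x k)) ∧
          (Finset.univ.filter fun j' : Fin N => j' ≠ l ∧ dist (x l) (x j') ≤ 1).card = 12 ∧
          (Finset.univ.filter fun j' : Fin N => j' ≠ l ∧ dist (x l) (x j') ≤ 11 / 10).card ≤ 12)) →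
      1 < dist (x i) (x j) → (131 : ℝ) / 100 ≤ dist (x i) (x j)) →
    (∀ (N : ℕ) (x : Fin N → EuclideanSpace ℝ (Fin 3)) (j k : Fin N),
      ((∀ j' : Fin N, dist (x j) (x j') ≤ 11 / 10 → ∀ k' : Fin N, k' ≠ j' →
          (55 : ℝ) / 57 ≤ dist (x j') (x k')) ∧
        (Finset.univ.filter fun j' : Fin N => j' ≠ j ∧ dist (x j) (x j') ≤ 1).card = 12 ∧
        (Finset.univ.filter fun j' : Fin N => j' ≠ j ∧ dist (x j) (x j') ≤ 11 / 10).card ≤ 12) →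
      (∀ l l' : Fin N, dist (x j) (x l) ≤ 1 → dist (x j) (x l') ≤ 1 → 1 < dist (x l) (x l') →
        (131 : ℝ) / 100 ≤ dist (x l) (x l')) →
      j ≠ k → dist (x j) (x k) ≤ 1 →
      (Finset.univ.filter fun l : Fin N =>
        l ≠ j ∧ l ≠ k ∧ dist (x j) (x l) ≤ 1 ∧ dist (x k) (x l) ≤ 1).card = 5 →
      (Finset.univ.filter fun k' : Fin N => k' ≠ j ∧ dist (x j) (x k') ≤ 1 ∧
        (Finset.univ.filter fun l : Fin N =>
          l ≠ j ∧ l ≠ k' ∧ dist (x j) (x l) ≤ 1 ∧ dist (x k') (x l) ≤ 1).card = 5).card = 2 ∧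
      ∀ k' : Fin N, k' ≠ j → dist (x j) (x k') ≤ 1 →
        (Finset.univ.filter fun l : Fin N =>
          l ≠ j ∧ l ≠ k' ∧ dist (x j) (x l) ≤ 1 ∧ dist (x k') (x l) ≤ 1).card = 5 → k' ≠ k →
        inner ℝ (x k - x j) (x k' - x j) ≤ -((19 : ℝ) / 20) * (‖x k - x j‖ * ‖x k' - x j‖)) →
    ∀ (N : ℕ) (x : Fin N → EuclideanSpace ℝ (Fin 3)) (i : Fin N) (D : ℝ),
    (∀ j : Fin N, dist (x i) (x j) ≤ 2 * D →
        ((∀ j' : Fin N, dist (x j) (x j') ≤ 11 / 10 → ∀ k : Fin N, k ≠ j' →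
            (55 : ℝ) / 57 ≤ dist (x j') (x k)) ∧
          (Finset.univ.filter fun j' : Fin N => j' ≠ j ∧ dist (x j) (x j') ≤ 1).card = 12 ∧
          (Finset.univ.filter fun j' : Fin N => j' ≠ j ∧ dist (x j) (x j') ≤ 11 / 10).card ≤ 12)) →
    ∀ j : Fin N, dist (x i) (x j) + 5 ≤ 2 * D →
    (Finset.univ.filter fun k' : Fin N => k' ≠ j ∧ dist (x j) (x k') ≤ 1 ∧
        (Finset.univ.filter fun l : Fin N =>
          l ≠ j ∧ l ≠ k' ∧ dist (x j) (x l) ≤ 1 ∧ dist (x k') (x l) ≤ 1).card = 5).card = 0 ∨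
    ((Finset.univ.filter fun k' : Fin N => k' ≠ j ∧ dist (x j) (x k') ≤ 1 ∧
        (Finset.univ.filter fun l : Fin N =>
          l ≠ j ∧ l ≠ k' ∧ dist (x j) (x l) ≤ 1 ∧ dist (x k') (x l) ≤ 1).card = 5).card = 2 ∧
      ∀ k ∈ (Finset.univ.filter fun k' : Fin N => k' ≠ j ∧ dist (x j) (x k') ≤ 1 ∧
        (Finset.univ.filter fun l : Fin N =>
          l ≠ j ∧ l ≠ k' ∧ dist (x j) (x l) ≤ 1 ∧ dist (x k') (x l) ≤ 1).card = 5),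
      ∀ k' ∈ (Finset.univ.filter fun k' : Fin N => k' ≠ j ∧ dist (x j) (x k') ≤ 1 ∧
        (Finset.univ.filter fun l : Fin N =>
          l ≠ j ∧ l ≠ k' ∧ dist (x j) (x l) ≤ 1 ∧ dist (x k') (x l) ≤ 1).card = 5),
      k' ≠ k →
        inner ℝ (x k - x j) (x k' - x j) ≤ -((19 : ℝ) / 20) * (‖x k - x j‖ * ‖x k' - x j‖)) :=
  fun hGap hCont _ x i D hGood j hj =>
    fiveFold_degree_zero_or_two_of_deep hGap hCont x i D hGood j hj

end Summit.AtomisticToContinuum.Crystallization.Theorems.SquareWellLayerCakeGapTwelveToBarlow
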